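import Summits.AtomisticToContinuum.Crystallization.Theorems.FrustratedLawDichotomyTransportPriceFinite

/-!
# FrustratedLawDichotomy · crux `AperiodicFrustratedLawGap` (stmt-AtomisticToContinuum-27623) — LOCALISATION IV: THE EQUILIBRIUM-LOADED FINITE-CLUSTER PRICE
# (decomp-a2c, prover hand 2, structural share, generation 3)

The finite-cluster residual of `…TransportPriceFinite` with hand 1's pointwise readings of Nash carried down to the cluster WITHOUT tail
error: for a cutoff `Rc ≥ 6/5 > (11/5)^(1/6)` every far term of the Laplacian sum `Σ (11 r⁻¹⁴ − 5 r⁻⁸)` is negative, so Laplacian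
stability of the infinite configuration gives EXACT nonnegativity of the truncated sum over the cluster, and the near-neighbour clause
(`dist^6 ≤ 11/5`, i.e. a neighbour within `(11/5)^(1/6) < 6/5`) is already local.  `truncatedSurplusPrice_of_equilibriumFiniteClusterPrice`:
the EQUILIBRIUM-LOADED FINITE-CLUSTER PRICE — as the finite-cluster price, for clusters that are moreover LOCALLY LAPLACIAN-STABLE
(`0 ≤ Σ_{q ∈ ω, q ≠ p, ‖q−p‖ ≤ Rc} (11‖q−p‖⁻¹⁴ − 5‖q−p‖⁻⁸)` at every `p ∈ ω` with `‖p‖ ≤ r`) and NEAR-NEIGHBOURED (every such `p` has `q ∈ ω`,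
`q ≠ p`, `|p−q|⁶ ≤ 11/5`) — implies the truncated surplus price, hence the crux BY NAME, the registered stub verbatim and the
`PeriodicChargeSplit` copy.  The weakest and most instrumentable residual of the transport line: a finite inequality over near-neighboured,
locally stable, textured, 7/10-separated finite clusters of radius `2r + Rc + 1`.  All `[folklore]`.
-/

noncomputable section

namespace Summit.AtomisticToContinuum.Crystallization.Theorems.FrustratedLawDichotomyTransportPriceFiniteEq

open MeasureTheory Metric Set Filter
open scoped ENNReal Topology BigOperators
open Literature.MathematicalPhysics.StatisticalMechanics Literature.Probability.Process
open Summit.AtomisticToContinuum.Crystallization.Theorems.ChargedEnergyGapNegative (E3 eStar)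
open Summit.AtomisticToContinuum.Crystallization.Theorems.FrustratedLawDichotomyTransportPriceTruncated
  (aperiodicFrustratedLawGap_of_truncatedSurplusPrice aperiodicErgodicGap_of_truncatedSurplusPrice
    periodicChargeSplit_aperiodicFrustratedLawGap_of_truncatedSurplusPrice)
open Summit.AtomisticToContinuum.Crystallization.Theorems.FrustratedLawDichotomyTransportPriceFinite
  (preimage_sub_closedBall map_sub_apply_closedBall count_restrict_closedBall_eq_card setIntegral_map_sub_eq_sum)
open Literature.Probability.Process.LocalConfig (finite_inter_of_separated)

/-- Far Laplacian terms are negative: for `d ≥ 6/5`, `11 d⁻¹⁴ − 5 d⁻⁸ ≤ 0`. [folklore] -/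
theorem laplacian_term_nonpos {d : ℝ} (hd : 6 / 5 ≤ d) : 11 * d⁻¹ ^ 14 - 5 * d⁻¹ ^ 8 ≤ 0 := by
  have hd0 : 0 < d := by linarith
  have hi0 : 0 ≤ d⁻¹ := inv_nonneg.mpr hd0.le
  have hi : d⁻¹ ≤ 5 / 6 := by rw [inv_le_comm₀ hd0 (by norm_num)]; norm_num; exact hd
  have h6 : d⁻¹ ^ 6 ≤ (5 / 6 : ℝ) ^ 6 := pow_le_pow_left₀ hi0 hi 6
  have h8 : 0 ≤ d⁻¹ ^ 8 := by positivity
  have h14 : d⁻¹ ^ 14 = d⁻¹ ^ 8 * d⁻¹ ^ 6 := by ring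
  rw [h14]
  nlinarith

/-- **Truncated Laplacian stability and the near neighbour, on the cluster.**  At a Laplacian-stable atom `p` of a rooted `7/10`-hard-core
configuration (`Σ_{q ≠ p} (11|p−q|⁻¹⁴ − 5|p−q|⁻⁸)` converges to some `L ≥ 0`), for `Rc ≥ 6/5` the sum over the atoms `q ≠ p` with `‖q − p‖ ≤ Rc`
is `≥ 0`. [folklore] -/
theorem truncated_laplacian_nonneg {S : Set E3} (hsep : ∀ a ∈ S, ∀ b ∈ S, a ≠ b → (7 : ℝ) / 10 ≤ dist a b) (p : E3) {Rc : ℝ} (hRc : 6 / 5 ≤ Rc)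
    {L : ℝ} (hL : 0 ≤ L)
    (hsum : HasSum (fun q : {q : E3 // (Measure.count : Measure E3).restrict S {q} ≠ 0 ∧ q ≠ p} =>
      11 * (dist p (q : E3))⁻¹ ^ 14 - 5 * (dist p (q : E3))⁻¹ ^ 8) L)
    (t : Finset E3) (ht : ∀ q : E3, q ∈ t ↔ (q ∈ S ∧ q ≠ p) ∧ ‖q - p‖ ≤ Rc) :
    0 ≤ ∑ q ∈ t, (11 * (dist p q)⁻¹ ^ 14 - 5 * (dist p q)⁻¹ ^ 8) := by
  classical
  set T := {q : E3 // (Measure.count : Measure E3).restrict S {q} ≠ 0 ∧ q ≠ p} with hT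
  set f : T → ℝ := fun q => 11 * (dist p (q : E3))⁻¹ ^ 14 - 5 * (dist p (q : E3))⁻¹ ^ 8 with hf
  have hmemT : ∀ q : T, (q : E3) ∈ S ∧ (q : E3) ≠ p := fun q =>
    ⟨(count_restrict_singleton_ne_zero_iff S q).mp q.2.1, q.2.2⟩
  -- the near part of `T` as a finset
  have hfin : (closedBall p Rc ∩ S).Finite := finite_inter_of_separated (by norm_num) hsep (isCompact_closedBall p Rc)
  have hnear : {q : T | ‖(q : E3) - p‖ ≤ Rc}.Finite := by
    refine Finite.of_injOn (f := fun q : T => (q : E3)) (fun q hq => ?_) (Subtype.val_injective.injOn) hfin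
    exact ⟨by rw [mem_closedBall, dist_eq_norm]; exact hq, (hmemT q).1⟩
  set s : Finset T := hnear.toFinset with hs
  have hcompl : ∑' q : ↑((↑s : Set T)ᶜ), f q ≤ 0 := by
    refine tsum_nonpos fun q => ?_
    have hq : ¬ ‖((q : T) : E3) - p‖ ≤ Rc := by
      have h1 : (q : T) ∉ (↑s : Set T) := q.2
      have h2 : (q : T) ∉ hnear.toFinset := h1
      rwa [Finite.mem_toFinset] at h2
    have hd : 6 / 5 ≤ dist p ((q : T) : E3) := by
      rw [dist_comm, dist_eq_norm]; linarith [not_le.mp hq]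
    exact laplacian_term_nonpos hd
  have hsplit := hsum.summable.sum_add_tsum_compl (s := s)
  rw [hsum.tsum_eq] at hsplit
  have hge : L ≤ ∑ q ∈ s, f q := by linarith
  -- transport the finset sum along `Subtype.val`
  have hmap : s.map (Function.Embedding.subtype _) = t := by
    ext q
    rw [Finset.mem_map, ht]
    constructor
    · rintro ⟨x, hx, rfl⟩
      rw [hs, Finite.mem_toFinset] at hx
      exact ⟨hmemT x, hx⟩
    · rintro ⟨⟨hqS, hqp⟩, hq⟩
      refine ⟨⟨q, (count_restrict_singleton_ne_zero_iff S q).mpr hqS, hqp⟩, ?_, rfl⟩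
      rw [hs, Finite.mem_toFinset]
      exact hq
  rw [← hmap, Finset.sum_map]
  exact hL.trans hge

/-- **EQUILIBRIUM-LOADED FINITE-CLUSTER PRICE ⟹ TRUNCATED SURPLUS PRICE.** [folklore] -/
theorem truncatedSurplusPrice_of_equilibriumFiniteClusterPrice
    (h : ∀ δ : ℝ, 0 < δ → ∀ R₇ R₈ R₉ : ℝ, let Gy : ℝ → (N : ℕ) → (Fin N → EuclideanSpace ℝ (Fin 3)) → Fin N → Prop := fun η N y j => let d : ℝ := sInf ((fun z => dist z (y (j : Fin N))) '' (Set.range (y) \ {(y (j : Fin N))})); let T : Set (EuclideanSpace ℝ (Fin 3)) := {z : EuclideanSpace ℝ (Fin 3) | z ∈ Set.range (y) ∧ z ≠ (y (j : Fin N)) ∧ dist z (y (j : Fin N)) < 13 / 10 * d}; ∃ A : EuclideanSpace ℝ (Fin 3) →ₗᵢ[ℝ] EuclideanSpace ℝ (Fin 3), (∃ e : ↥T ≃ ↥Literature.Geometry.DiscreteGeometry.fccKissingPattern, ∀ t : ↥T, dist (d⁻¹ • ((t : EuclideanSpace ℝ (Fin 3)) - (y (j : Fin N)))) (A ((e t :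 ↥Literature.Geometry.DiscreteGeometry.fccKissingPattern) : EuclideanSpace ℝ (Fin 3))) ≤ η) ∨ (∃ e : ↥T ≃ ↥Literature.Geometry.DiscreteGeometry.hcpKissingPattern, ∀ t : ↥T, dist (d⁻¹ • ((t : EuclideanSpace ℝ (Fin 3)) - (y (j : Fin N)))) (A ((e t : ↥Literature.Geometry.DiscreteGeometry.hcpKissingPattern) : EuclideanSpace ℝ (Fin 3))) ≤ η); let TexBall : (N : ℕ) → (Fin N → EuclideanSpace ℝ (Fin 3)) → Fin N → ℝ → ℝ → ℝ → ℝ → Prop := fun N y i R R₇ R₈ R₉ => (∀ a b : Fin N, a ≠ b → (7 : ℝ) / 10 ≤ dist (y a) (y b)) ∧ (∀ j : Fin N, dist (y j) (y i) ≤ R → ¬ Gy (1 / 20) N (y) j) ∧ (∀ j : Fin N, dist (y j) (y i) ≤ R → ¬ ((∀ j' : Fin N, dist (y j') (y j) ≤ R₇ → ¬ Gy (1 / 20) N (y) j') ∧ (∀ z : EuclideanSpace ℝ (Fin 3), dist z (y j) ≤ R₇ → ∃ k : Fin N, dist z (y k) ≤ 1) ∧ (∀ j' : Fin N, dist (y j')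 (y j) ≤ R₇ → (let d : ℝ := sInf ((fun z => dist z (y j')) '' (Set.range (y) \ {(y j')})); ∀ k : Fin N, y k ≠ y j' → dist (y k) (y j') < 27 / 20 * d → 5 ≤ Nat.card {m : Fin N // y m ≠ y j' ∧ dist (y m) (y j') < 27 / 20 * d ∧ y m ≠ y k ∧ dist (y m) (y k) < 27 / 20 * d})))) ∧ (∀ j : Fin N, dist (y j) (y i) ≤ R → ∃ k : Fin N, dist (y k) (y j) ≤ R₈ ∧ Gy (1 / 8) N (y) k) ∧ (∀ j : Fin N, dist (y j) (y i) ≤ R → ¬ ((∀ j' : Fin N, dist (y j') (y j) ≤ R₉ → ¬ Gy (1 / 20) N (y) j') ∧ (Nat.card {j' : Fin N // dist (y j') (y j) ≤ R₉ ∧ ¬ Gy (1 / 8) N (y) j'} : ℝ) ≤ 1 / 2 * (Nat.card {j' : Fin N // dist (y j') (y j) ≤ R₉} : ℝ) ∧ (∀ j' : Fin N, dist (y j') (y j) ≤ R₉ → ¬ Gy (1 / 8) N (y) j' → ¬ (let d : ℝ := sInf ((fun z => dist z (y j')) '' (Set.range (y) \ {(y j')})); ∀ k : Fin N, y k ≠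 y j' → dist (y k) (y j') < 27 / 20 * d → 5 ≤ Nat.card {m : Fin N // y m ≠ y j' ∧ dist (y m) (y j') < 27 / 20 * d ∧ y m ≠ y k ∧ dist (y m) (y k) < 27 / 20 * d})))); ∃ r : ℝ, 0 < r ∧ ∃ Rc : ℝ, 6 / 5 ≤ Rc ∧ ∀ ω : Finset (EuclideanSpace ℝ (Fin 3)), (0 : EuclideanSpace ℝ (Fin 3)) ∈ ω → (∀ p ∈ ω, ‖p‖ ≤ 2 * r + Rc + 1) → (∀ a ∈ ω, ∀ b ∈ ω, a ≠ b → δ ≤ dist a b) → (∀ a ∈ ω, ∀ b ∈ ω, a ≠ b → (7 : ℝ) / 10 ≤ dist a b) → (∀ q ∈ ω, ‖q‖ ≤ r → ∀ ε : ℝ, 0 < ε → ε ≤ 1 → ∃ (N : ℕ) (y : Fin N → EuclideanSpace ℝ (Fin 3)) (i : Fin N), TexBall N y i (r + Rc) R₇ R₈ R₉ ∧ (∀ p ∈ ω, dist p q ≤ r + Rc → ∃ k : Fin N, dist (y k - y i) (p - q) ≤ ε) ∧ (∀ k : Fin N, dist (y k) (y i) ≤ r + Rc → ∃ p ∈ ω,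 dist (y k - y i) (p - q) ≤ ε)) → (∀ p ∈ ω, ‖p‖ ≤ r → ∃ q ∈ ω, q ≠ p ∧ dist p q ^ 6 ≤ 11 / 5) → (∀ p ∈ ω, ‖p‖ ≤ r → 0 ≤ ∑ q ∈ ω.filter (fun q : EuclideanSpace ℝ (Fin 3) => q ≠ p ∧ ‖q - p‖ ≤ Rc), (11 * (dist p q)⁻¹ ^ 14 - 5 * (dist p q)⁻¹ ^ 8)) → 0 < (∑ y ∈ ω.filter (fun y : EuclideanSpace ℝ (Fin 3) => ‖y‖ ≤ r), ((∑ q ∈ ω.filter (fun q : EuclideanSpace ℝ (Fin 3) => ‖q - y‖ ≤ Rc), Literature.MathematicalPhysics.StatisticalMechanics.lennardJones ‖q - y‖) / 2 - ((7 / 10 : ℝ)⁻¹ ^ 6 / 12 + 1 / 6) * (250 * (7 / 10 : ℝ)⁻¹ ^ 3 * Rc⁻¹ ^ 3) / 2 - (⨅ Q : Literature.MathematicalPhysics.StatisticalMechanics.PeriodicConfiguration 3, Q.energyPerParticle Literature.MathematicalPhysics.StatisticalMechanics.lennardJones)) / ((ω.filter (fun q : EuclideanSpace ℝ (Fin 3)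 => ‖q - y‖ ≤ r)).card : ℝ))) :
    ∀ δ : ℝ, 0 < δ → ∀ R₇ R₈ R₉ : ℝ, let Gy : ℝ → (N : ℕ) → (Fin N → EuclideanSpace ℝ (Fin 3)) → Fin N → Prop := fun η N y j => let d : ℝ := sInf ((fun z => dist z (y (j : Fin N))) '' (Set.range (y) \ {(y (j : Fin N))})); let T : Set (EuclideanSpace ℝ (Fin 3)) := {z : EuclideanSpace ℝ (Fin 3) | z ∈ Set.range (y) ∧ z ≠ (y (j : Fin N)) ∧ dist z (y (j : Fin N)) < 13 / 10 * d}; ∃ A : EuclideanSpace ℝ (Fin 3) →ₗᵢ[ℝ] EuclideanSpace ℝ (Fin 3), (∃ e : ↥T ≃ ↥Literature.Geometry.DiscreteGeometry.fccKissingPattern, ∀ t : ↥T, dist (d⁻¹ • ((t : EuclideanSpace ℝ (Fin 3)) - (y (j : Fin N)))) (A ((e t : ↥Literature.Geometry.DiscreteGeometry.fccKissingPattern) : EuclideanSpace ℝ (Fin 3))) ≤ η) ∨ (∃ e : ↥T ≃ ↥Literature.Geometry.DiscreteGeometry.hcpKissingPattern, ∀ t : ↥T, dist (d⁻¹ • ((t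 : EuclideanSpace ℝ (Fin 3)) - (y (j : Fin N)))) (A ((e t : ↥Literature.Geometry.DiscreteGeometry.hcpKissingPattern) : EuclideanSpace ℝ (Fin 3))) ≤ η); let TexBall : (N : ℕ) → (Fin N → EuclideanSpace ℝ (Fin 3)) → Fin N → ℝ → ℝ → ℝ → ℝ → Prop := fun N y i R R₇ R₈ R₉ => (∀ a b : Fin N, a ≠ b → (7 : ℝ) / 10 ≤ dist (y a) (y b)) ∧ (∀ j : Fin N, dist (y j) (y i) ≤ R → ¬ Gy (1 / 20) N (y) j) ∧ (∀ j : Fin N, dist (y j) (y i) ≤ R → ¬ ((∀ j' : Fin N, dist (y j') (y j) ≤ R₇ → ¬ Gy (1 / 20) N (y) j') ∧ (∀ z : EuclideanSpace ℝ (Fin 3), dist z (y j) ≤ R₇ → ∃ k : Fin N, dist z (y k) ≤ 1) ∧ (∀ j' : Fin N, dist (y j') (y j) ≤ R₇ → (let d : ℝ := sInf ((fun z => dist z (y j')) '' (Set.range (y) \ {(y j')})); ∀ k : Fin N, y k ≠ y j' → dist (y k) (y j') < 27 / 20 * d → 5 ≤ Nat.card {m : Fin N // y m ≠ y j' ∧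 dist (y m) (y j') < 27 / 20 * d ∧ y m ≠ y k ∧ dist (y m) (y k) < 27 / 20 * d})))) ∧ (∀ j : Fin N, dist (y j) (y i) ≤ R → ∃ k : Fin N, dist (y k) (y j) ≤ R₈ ∧ Gy (1 / 8) N (y) k) ∧ (∀ j : Fin N, dist (y j) (y i) ≤ R → ¬ ((∀ j' : Fin N, dist (y j') (y j) ≤ R₉ → ¬ Gy (1 / 20) N (y) j') ∧ (Nat.card {j' : Fin N // dist (y j') (y j) ≤ R₉ ∧ ¬ Gy (1 / 8) N (y) j'} : ℝ) ≤ 1 / 2 * (Nat.card {j' : Fin N // dist (y j') (y j) ≤ R₉} : ℝ) ∧ (∀ j' : Fin N, dist (y j') (y j) ≤ R₉ → ¬ Gy (1 / 8) N (y) j' → ¬ (let d : ℝ := sInf ((fun z => dist z (y j')) '' (Set.range (y) \ {(y j')})); ∀ k : Fin N, y k ≠ y j' → dist (y k) (y j') < 27 / 20 * d → 5 ≤ Nat.card {m : Fin N // y m ≠ y j' ∧ dist (y m) (y j') < 27 / 20 * d ∧ y m ≠ y k ∧ dist (y m) (y k) < 27 / 20 * d})))); let Appr : MeasureTheory.Measure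 (EuclideanSpace ℝ (Fin 3)) → ℝ → ℝ → ℝ → Prop := fun μ R₇ R₈ R₉ => ∀ q : EuclideanSpace ℝ (Fin 3), μ {q} ≠ 0 → ∀ R ε : ℝ, 0 < ε → ∃ (N : ℕ) (y : Fin N → EuclideanSpace ℝ (Fin 3)) (i : Fin N), TexBall N y i R R₇ R₈ R₉ ∧ (∀ p : EuclideanSpace ℝ (Fin 3), μ {p} ≠ 0 → dist p q ≤ R → ∃ k : Fin N, dist (y k - y i) (p - q) ≤ ε) ∧ (∀ k : Fin N, dist (y k) (y i) ≤ R → ∃ p : EuclideanSpace ℝ (Fin 3), μ {p} ≠ 0 ∧ dist (y k - y i) (p - q) ≤ ε); ∃ r : ℝ, 0 < r ∧ ∃ Rc : ℝ, 7 / 10 ≤ Rc ∧ (∀ μ : MeasureTheory.Measure (EuclideanSpace ℝ (Fin 3)), Literature.Probability.Process.IsRootedHardCore δ μ → Literature.Probability.Process.IsRootedHardCore (7 / 10) μ → Appr μ R₇ R₈ R₉ → (∀ p : EuclideanSpace ℝ (Fin 3), μ {p} ≠ 0 → ∀ y : EuclideanSpace ℝ (Fin 3), (∀ q : EuclideanSpace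 ℝ (Fin 3), μ {q} ≠ 0 → q ≠ p → y ≠ q) → ∑' q : {q : EuclideanSpace ℝ (Fin 3) // μ {q} ≠ 0 ∧ q ≠ p}, Literature.MathematicalPhysics.StatisticalMechanics.lennardJones (dist p (q : EuclideanSpace ℝ (Fin 3))) ≤ ∑' q : {q : EuclideanSpace ℝ (Fin 3) // μ {q} ≠ 0 ∧ q ≠ p}, Literature.MathematicalPhysics.StatisticalMechanics.lennardJones (dist y (q : EuclideanSpace ℝ (Fin 3)))) → (∀ p : EuclideanSpace ℝ (Fin 3), μ {p} ≠ 0 → HasSum (fun q : {q : EuclideanSpace ℝ (Fin 3) // μ {q} ≠ 0 ∧ q ≠ p} => ((dist p (q : EuclideanSpace ℝ (Fin 3)))⁻¹ ^ 8 - (dist p (q : EuclideanSpace ℝ (Fin 3)))⁻¹ ^ 14) • (p - (q : EuclideanSpace ℝ (Fin 3)))) 0 ∧ (∃ L : ℝ, 0 ≤ L ∧ HasSum (fun q : {q : EuclideanSpace ℝ (Fin 3) // μ {q} ≠ 0 ∧ q ≠ p} => 11 * (dist p (q : EuclideanSpace ℝ (Fin 3)))⁻¹ ^ 14 - 5 *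 (dist p (q : EuclideanSpace ℝ (Fin 3)))⁻¹ ^ 8) L) ∧ ((∃ q : EuclideanSpace ℝ (Fin 3), μ {q} ≠ 0 ∧ q ≠ p) → ∃ q : EuclideanSpace ℝ (Fin 3), μ {q} ≠ 0 ∧ q ≠ p ∧ dist p q ^ 6 ≤ 11 / 5)) → {p : EuclideanSpace ℝ (Fin 3) | μ {p} ≠ 0}.Infinite → ¬ (∃ Q : Literature.MathematicalPhysics.StatisticalMechanics.PeriodicConfiguration 3, ∃ t : EuclideanSpace ℝ (Fin 3), {p : EuclideanSpace ℝ (Fin 3) | μ {p} ≠ 0} = (fun s => s + t) '' Q.points) → 0 < (∫ y in Metric.closedBall (0 : EuclideanSpace ℝ (Fin 3)) r, ((∫ z in Metric.closedBall (0 : EuclideanSpace ℝ (Fin 3)) Rc, Literature.MathematicalPhysics.StatisticalMechanics.lennardJones ‖z‖ ∂(MeasureTheory.Measure.map (fun z : EuclideanSpace ℝ (Fin 3) => z - y) μ)) / 2 - ((7 / 10 : ℝ)⁻¹ ^ 6 / 12 + 1 / 6) * (250 * (7 / 10 : ℝ)⁻¹ ^ 3 * Rc⁻¹ ^ 3) /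 2 - (⨅ Q : Literature.MathematicalPhysics.StatisticalMechanics.PeriodicConfiguration 3, Q.energyPerParticle Literature.MathematicalPhysics.StatisticalMechanics.lennardJones)) / ((MeasureTheory.Measure.map (fun z : EuclideanSpace ℝ (Fin 3) => z - y) μ) (Metric.closedBall (0 : EuclideanSpace ℝ (Fin 3)) r)).toReal ∂μ)) := by
  classical
  intro δ hδ R₇ R₈ R₉
  have h' := h δ hδ R₇ R₈ R₉
  dsimp only at h' ⊢
  obtain ⟨r, hr, Rc, hRc, hF⟩ := h'
  refine ⟨r, hr, Rc, by linarith, fun μ hμδ hμ7 hd he hE hinf hnp => ?_⟩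
  obtain ⟨S, h0S, hsep, hμS⟩ := id hμ7
  have h7 : (0 : ℝ) < 7 / 10 := by norm_num
  have hsepδ : ∀ a ∈ S, ∀ b ∈ S, a ≠ b → δ ≤ dist a b := by
    obtain ⟨S', -, hsep', hμS'⟩ := hμδ
    intro a ha b hb hab
    have ha' : a ∈ S' := (count_restrict_singleton_ne_zero_iff S' a).mp (by rw [← hμS', hμS]; exact (count_restrict_singleton_ne_zero_iff S a).mpr ha)
    have hb' : b ∈ S' := (count_restrict_singleton_ne_zero_iff S' b).mp (by rw [← hμS', hμS]; exact (count_restrict_singleton_ne_zero_iff S b).mpr hb)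
    exact hsep' a ha' b hb' hab
  set ρ : ℝ := 2 * r + Rc + 1 with hρ
  have hrρ : r ≤ ρ := by rw [hρ]; linarith
  have hρ0 : 0 ≤ ρ := by rw [hρ]; linarith
  have hfinρ : (closedBall (0 : E3) ρ ∩ S).Finite := finite_inter_of_separated h7 hsep (isCompact_closedBall (0 : E3) ρ)
  set ω : Finset E3 := hfinρ.toFinset with hω
  have hmemω : ∀ p : E3, p ∈ ω ↔ ‖p‖ ≤ ρ ∧ p ∈ S := fun p => by
    rw [hω, Finite.mem_toFinset, mem_inter_iff, mem_closedBall, dist_zero_right]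
  have h0ω : (0 : E3) ∈ ω := (hmemω 0).mpr ⟨by rw [norm_zero]; exact hρ0, h0S⟩
  have hballω : ∀ p ∈ ω, ‖p‖ ≤ 2 * r + Rc + 1 := fun p hp => by have := ((hmemω p).mp hp).1; rw [hρ] at this; exact this
  have hsepω : ∀ a ∈ ω, ∀ b ∈ ω, a ≠ b → δ ≤ dist a b := fun a ha b hb hab =>
    hsepδ a ((hmemω a).mp ha).2 b ((hmemω b).mp hb).2 hab
  have hsep7ω : ∀ a ∈ ω, ∀ b ∈ ω, a ≠ b → (7 : ℝ) / 10 ≤ dist a b := fun a ha b hb hab =>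
    hsep a ((hmemω a).mp ha).2 b ((hmemω b).mp hb).2 hab
  have hball_sub : ∀ y : E3, ‖y‖ ≤ r → ∀ R : ℝ, R ≤ r + Rc → ∀ q : E3, ‖q - y‖ ≤ R → ‖q‖ ≤ ρ := by
    intro y hy R hR q hq
    calc ‖q‖ = ‖(q - y) + y‖ := by rw [sub_add_cancel]
      _ ≤ ‖q - y‖ + ‖y‖ := norm_add_le _ _
      _ ≤ ρ := by rw [hρ]; linarith
  have hatom : ∀ p ∈ ω, μ {p} ≠ 0 := fun p hp => by
    rw [hμS]; exact (count_restrict_singleton_ne_zero_iff S p).mpr ((hmemω p).mp hp).2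
  -- the finite inequality, with texture / near neighbour / truncated Laplacian stability supplied from the configuration
  have hpos := hF ω h0ω hballω hsepω hsep7ω (fun q hq hqr ε hε hε1 => by
      obtain ⟨N, y, i, hT, hm1, hm2⟩ := hd q (hatom q hq) (r + Rc) ε hε
      refine ⟨N, y, i, hT, fun p hp hpq => hm1 p (hatom p hp) hpq, fun k hk => ?_⟩
      obtain ⟨p, hp0, hpk⟩ := hm2 k hk
      have hpS : p ∈ S := by rw [hμS] at hp0; exact (count_restrict_singleton_ne_zero_iff S p).mp hp0
      refine ⟨p, (hmemω p).mpr ⟨?_, hpS⟩, hpk⟩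
      have h1 : ‖p - q‖ ≤ ‖y k - y i‖ + ε := by
        have hdk : ‖p - q - (y k - y i)‖ ≤ ε := by
          rw [← dist_eq_norm, dist_comm]; exact hpk
        calc ‖p - q‖ = ‖(p - q - (y k - y i)) + (y k - y i)‖ := by rw [sub_add_cancel]
          _ ≤ ‖p - q - (y k - y i)‖ + ‖y k - y i‖ := norm_add_le _ _
          _ ≤ ‖y k - y i‖ + ε := by linarith
      have h2 : ‖y k - y i‖ ≤ r + Rc := by rw [← dist_eq_norm]; exact hk
      calc ‖p‖ = ‖(p - q) + q‖ := by rw [sub_add_cancel]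
        _ ≤ ‖p - q‖ + ‖q‖ := norm_add_le _ _
        _ ≤ ρ := by rw [hρ]; linarith)
    (fun p hp hpr => by
      -- near neighbour within (11/5)^(1/6) < 6/5, hence inside the cluster
      obtain ⟨-, -, hnear⟩ := hE p (hatom p hp)
      obtain ⟨q', hq'mem, hq'p⟩ := hinf.exists_notMem_finset {p}
      have hq'ne : q' ≠ p := fun h => hq'p (by rw [h]; exact Finset.mem_singleton_self p)
      obtain ⟨q, hq0, hqp, hqd⟩ := hnear ⟨q', hq'mem, hq'ne⟩
      have hqS : q ∈ S := by rw [hμS] at hq0; exact (count_restrict_singleton_ne_zero_iff S q).mp hq0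
      have hdist : dist p q ≤ 6 / 5 := by
        by_contra hlt
        have hgt : 6 / 5 < dist p q := not_le.mp hlt
        have : (6 / 5 : ℝ) ^ 6 < dist p q ^ 6 := by gcongr
        norm_num at this
        linarith
      refine ⟨q, (hmemω q).mpr ⟨?_, hqS⟩, hqp, hqd⟩
      have : ‖q - p‖ ≤ 6 / 5 := by rw [← dist_eq_norm, dist_comm]; exact hdist
      calc ‖q‖ = ‖(q - p) + p‖ := by rw [sub_add_cancel]
        _ ≤ ‖q - p‖ + ‖p‖ := norm_add_le _ _
        _ ≤ ρ := by rw [hρ]; linarith)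
    (fun p hp hpr => by
      obtain ⟨-, ⟨L, hL0, hsum⟩, -⟩ := hE p (hatom p hp)
      rw [hμS] at hsum
      refine truncated_laplacian_nonneg hsep p hRc hL0 hsum _ fun q => ?_
      rw [Finset.mem_filter, hmemω]
      constructor
      · rintro ⟨⟨-, hqS⟩, hqp, hq⟩; exact ⟨⟨hqS, hqp⟩, hq⟩
      · rintro ⟨⟨hqS, hqp⟩, hq⟩; exact ⟨⟨hball_sub p hpr Rc (by linarith) q hq, hqS⟩, hqp, hq⟩)
  -- the truncated integral IS the finite sum
  have hfinr : (closedBall (0 : E3) r ∩ S).Finite := finite_inter_of_separated h7 hsep (isCompact_closedBall (0 : E3) r)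
  have hωr : hfinr.toFinset = ω.filter (fun y : E3 => ‖y‖ ≤ r) := by
    ext y
    rw [Finite.mem_toFinset, Finset.mem_filter, hmemω, mem_inter_iff, mem_closedBall, dist_zero_right]
    constructor
    · rintro ⟨hy, hyS⟩; exact ⟨⟨hy.trans hrρ, hyS⟩, hy⟩
    · rintro ⟨⟨-, hyS⟩, hy⟩; exact ⟨hy, hyS⟩
  have hfilt : ∀ y : E3, ‖y‖ ≤ r → ∀ R : ℝ, R ≤ r + Rc → ∀ hfin : (closedBall y R ∩ S).Finite,
      hfin.toFinset = ω.filter (fun q : E3 => ‖q - y‖ ≤ R) := by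
    intro y hy R hR hfin
    ext q
    rw [Finite.mem_toFinset, Finset.mem_filter, hmemω, mem_inter_iff, mem_closedBall, dist_eq_norm]
    constructor
    · rintro ⟨hq, hqS⟩; exact ⟨⟨hball_sub y hy R hR q hq, hqS⟩, hq⟩
    · rintro ⟨⟨-, hqS⟩, hq⟩; exact ⟨hq, hqS⟩
  have heq : (∫ y in closedBall (0 : E3) r, ((∫ z in closedBall (0 : E3) Rc, lennardJones ‖z‖ ∂(μ.map fun z : E3 => z - y)) / 2 -
        ((7 / 10 : ℝ)⁻¹ ^ 6 / 12 + 1 / 6) * (250 * (7 / 10 : ℝ)⁻¹ ^ 3 * Rc⁻¹ ^ 3) / 2 -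
        (⨅ Q : PeriodicConfiguration 3, Q.energyPerParticle lennardJones)) /
        ((μ.map fun z : E3 => z - y) (closedBall (0 : E3) r)).toReal ∂μ) =
      ∑ y ∈ ω.filter (fun y : E3 => ‖y‖ ≤ r),
        ((∑ q ∈ ω.filter (fun q : E3 => ‖q - y‖ ≤ Rc), lennardJones ‖q - y‖) / 2 -
          ((7 / 10 : ℝ)⁻¹ ^ 6 / 12 + 1 / 6) * (250 * (7 / 10 : ℝ)⁻¹ ^ 3 * Rc⁻¹ ^ 3) / 2 -
          (⨅ Q : PeriodicConfiguration 3, Q.energyPerParticle lennardJones)) /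
        ((ω.filter (fun q : E3 => ‖q - y‖ ≤ r)).card : ℝ) := by
    rw [hμS, Measure.restrict_restrict measurableSet_closedBall]
    have hcoe : (Measure.count : Measure E3).restrict (closedBall (0 : E3) r ∩ S) =
        (Measure.count : Measure E3).restrict (↑hfinr.toFinset : Set E3) := by rw [Finite.coe_toFinset]
    rw [hcoe, integral_count_restrict_coe_finset, hωr]
    refine Finset.sum_congr rfl fun y hy => ?_
    have hyr : ‖y‖ ≤ r := (Finset.mem_filter.mp hy).2
    have hfinRc : (closedBall y Rc ∩ S).Finite := finite_inter_of_separated h7 hsep (isCompact_closedBall y Rc)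
    have hfinyr : (closedBall y r ∩ S).Finite := finite_inter_of_separated h7 hsep (isCompact_closedBall y r)
    rw [setIntegral_map_sub_eq_sum y Rc hfinRc, hfilt y hyr Rc (by linarith) hfinRc, map_sub_apply_closedBall,
      count_restrict_closedBall_eq_card y r hfinyr, hfilt y hyr r (by linarith) hfinyr, ENNReal.toReal_natCast]
  rw [heq]
  exact hpos

/-- **EQUILIBRIUM-LOADED FINITE-CLUSTER DOOR (crux, by name).** [folklore] -/
theorem aperiodicFrustratedLawGap_of_equilibriumFiniteClusterPrice
    (h : ∀ δ : ℝ, 0 < δ → ∀ R₇ R₈ R₉ : ℝ, let Gy : ℝ → (N : ℕ) → (Fin N → EuclideanSpace ℝ (Fin 3)) → Fin N → Prop := fun η N y j => let d : ℝ := sInf ((fun z => dist z (y (j : Fin N))) '' (Set.range (y) \ {(y (j : Fin N))})); let T : Set (EuclideanSpace ℝ (Fin 3)) := {z : EuclideanSpace ℝ (Fin 3) | z ∈ Set.range (y) ∧ z ≠ (y (j : Fin N)) ∧ dist z (y (j : Fin N)) < 13 / 10 * d}; ∃ A : EuclideanSpace ℝ (Fin 3) →ₗᵢ[ℝ] EuclideanSpace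 ℝ (Fin 3), (∃ e : ↥T ≃ ↥Literature.Geometry.DiscreteGeometry.fccKissingPattern, ∀ t : ↥T, dist (d⁻¹ • ((t : EuclideanSpace ℝ (Fin 3)) - (y (j : Fin N)))) (A ((e t : ↥Literature.Geometry.DiscreteGeometry.fccKissingPattern) : EuclideanSpace ℝ (Fin 3))) ≤ η) ∨ (∃ e : ↥T ≃ ↥Literature.Geometry.DiscreteGeometry.hcpKissingPattern, ∀ t : ↥T, dist (d⁻¹ • ((t : EuclideanSpace ℝ (Fin 3)) - (y (j : Fin N)))) (A ((e t : ↥Literature.Geometry.DiscreteGeometry.hcpKissingPattern) : EuclideanSpace ℝ (Fin 3))) ≤ η); let TexBall : (N : ℕ) → (Fin N → EuclideanSpace ℝ (Fin 3)) → Fin N → ℝ → ℝ → ℝ → ℝ → Prop := fun N y i R R₇ R₈ R₉ => (∀ a b : Fin N, a ≠ b → (7 : ℝ) / 10 ≤ dist (y a) (y b)) ∧ (∀ j : Fin N, dist (y j) (y i) ≤ R → ¬ Gy (1 / 20) N (y) j) ∧ (∀ j : Fin N, dist (y j) (y i) ≤ R → ¬ ((∀ j' : Fin N, dist (y j') (y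 j) ≤ R₇ → ¬ Gy (1 / 20) N (y) j') ∧ (∀ z : EuclideanSpace ℝ (Fin 3), dist z (y j) ≤ R₇ → ∃ k : Fin N, dist z (y k) ≤ 1) ∧ (∀ j' : Fin N, dist (y j') (y j) ≤ R₇ → (let d : ℝ := sInf ((fun z => dist z (y j')) '' (Set.range (y) \ {(y j')})); ∀ k : Fin N, y k ≠ y j' → dist (y k) (y j') < 27 / 20 * d → 5 ≤ Nat.card {m : Fin N // y m ≠ y j' ∧ dist (y m) (y j') < 27 / 20 * d ∧ y m ≠ y k ∧ dist (y m) (y k) < 27 / 20 * d})))) ∧ (∀ j : Fin N, dist (y j) (y i) ≤ R → ∃ k : Fin N, dist (y k) (y j) ≤ R₈ ∧ Gy (1 / 8) N (y) k) ∧ (∀ j : Fin N, dist (y j) (y i) ≤ R → ¬ ((∀ j' : Fin N, dist (y j') (y j) ≤ R₉ → ¬ Gy (1 / 20) N (y) j') ∧ (Nat.card {j' : Fin N // dist (y j') (y j) ≤ R₉ ∧ ¬ Gy (1 / 8) N (y) j'} : ℝ) ≤ 1 / 2 * (Nat.card {j' : Fin N // dist (y j') (y j) ≤ R₉} : ℝ)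 ∧ (∀ j' : Fin N, dist (y j') (y j) ≤ R₉ → ¬ Gy (1 / 8) N (y) j' → ¬ (let d : ℝ := sInf ((fun z => dist z (y j')) '' (Set.range (y) \ {(y j')})); ∀ k : Fin N, y k ≠ y j' → dist (y k) (y j') < 27 / 20 * d → 5 ≤ Nat.card {m : Fin N // y m ≠ y j' ∧ dist (y m) (y j') < 27 / 20 * d ∧ y m ≠ y k ∧ dist (y m) (y k) < 27 / 20 * d})))); ∃ r : ℝ, 0 < r ∧ ∃ Rc : ℝ, 6 / 5 ≤ Rc ∧ ∀ ω : Finset (EuclideanSpace ℝ (Fin 3)), (0 : EuclideanSpace ℝ (Fin 3)) ∈ ω → (∀ p ∈ ω, ‖p‖ ≤ 2 * r + Rc + 1) → (∀ a ∈ ω, ∀ b ∈ ω, a ≠ b → δ ≤ dist a b) → (∀ a ∈ ω, ∀ b ∈ ω, a ≠ b → (7 : ℝ) / 10 ≤ dist a b) → (∀ q ∈ ω, ‖q‖ ≤ r → ∀ ε : ℝ, 0 < ε → ε ≤ 1 → ∃ (N : ℕ) (y : Fin N → EuclideanSpace ℝ (Fin 3)) (i : Fin N), TexBall N y i (r + Rc)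 R₇ R₈ R₉ ∧ (∀ p ∈ ω, dist p q ≤ r + Rc → ∃ k : Fin N, dist (y k - y i) (p - q) ≤ ε) ∧ (∀ k : Fin N, dist (y k) (y i) ≤ r + Rc → ∃ p ∈ ω, dist (y k - y i) (p - q) ≤ ε)) → (∀ p ∈ ω, ‖p‖ ≤ r → ∃ q ∈ ω, q ≠ p ∧ dist p q ^ 6 ≤ 11 / 5) → (∀ p ∈ ω, ‖p‖ ≤ r → 0 ≤ ∑ q ∈ ω.filter (fun q : EuclideanSpace ℝ (Fin 3) => q ≠ p ∧ ‖q - p‖ ≤ Rc), (11 * (dist p q)⁻¹ ^ 14 - 5 * (dist p q)⁻¹ ^ 8)) → 0 < (∑ y ∈ ω.filter (fun y : EuclideanSpace ℝ (Fin 3) => ‖y‖ ≤ r), ((∑ q ∈ ω.filter (fun q : EuclideanSpace ℝ (Fin 3) => ‖q - y‖ ≤ Rc), Literature.MathematicalPhysics.StatisticalMechanics.lennardJones ‖q - y‖) / 2 - ((7 / 10 : ℝ)⁻¹ ^ 6 / 12 + 1 / 6) * (250 * (7 / 10 : ℝ)⁻¹ ^ 3 * Rc⁻¹ ^ 3) /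 2 - (⨅ Q : Literature.MathematicalPhysics.StatisticalMechanics.PeriodicConfiguration 3, Q.energyPerParticle Literature.MathematicalPhysics.StatisticalMechanics.lennardJones)) / ((ω.filter (fun q : EuclideanSpace ℝ (Fin 3) => ‖q - y‖ ≤ r)).card : ℝ))) :
    Summit.AtomisticToContinuum.Crystallization.Theses.FrustratedLawDichotomy.AperiodicFrustratedLawGap :=
  aperiodicFrustratedLawGap_of_truncatedSurplusPrice (truncatedSurplusPrice_of_equilibriumFiniteClusterPrice h)

/-- **EQUILIBRIUM-LOADED FINITE-CLUSTER DOOR for the registered stub** (`S_aperiodicErgodicGap` verbatim). [folklore] -/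
theorem aperiodicErgodicGap_of_equilibriumFiniteClusterPrice
    (h : ∀ δ : ℝ, 0 < δ → ∀ R₇ R₈ R₉ : ℝ, let Gy : ℝ → (N : ℕ) → (Fin N → EuclideanSpace ℝ (Fin 3)) → Fin N → Prop := fun η N y j => let d : ℝ := sInf ((fun z => dist z (y (j : Fin N))) '' (Set.range (y) \ {(y (j : Fin N))})); let T : Set (EuclideanSpace ℝ (Fin 3)) := {z : EuclideanSpace ℝ (Fin 3) | z ∈ Set.range (y) ∧ z ≠ (y (j : Fin N)) ∧ dist z (y (j : Fin N)) < 13 / 10 * d}; ∃ A : EuclideanSpace ℝ (Fin 3) →ₗᵢ[ℝ] EuclideanSpace ℝ (Fin 3), (∃ e : ↥T ≃ ↥Literature.Geometry.DiscreteGeometry.fccKissingPattern, ∀ t : ↥T, dist (d⁻¹ • ((t : EuclideanSpace ℝ (Fin 3)) - (y (j : Fin N)))) (A ((e t : ↥Literature.Geometry.DiscreteGeometry.fccKissingPattern) : EuclideanSpace ℝ (Fin 3))) ≤ η) ∨ (∃ e : ↥T ≃ ↥Literature.Geometry.DiscreteGeometry.hcpKissingPattern, ∀ t : ↥T, dist (d⁻¹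 • ((t : EuclideanSpace ℝ (Fin 3)) - (y (j : Fin N)))) (A ((e t : ↥Literature.Geometry.DiscreteGeometry.hcpKissingPattern) : EuclideanSpace ℝ (Fin 3))) ≤ η); let TexBall : (N : ℕ) → (Fin N → EuclideanSpace ℝ (Fin 3)) → Fin N → ℝ → ℝ → ℝ → ℝ → Prop := fun N y i R R₇ R₈ R₉ => (∀ a b : Fin N, a ≠ b → (7 : ℝ) / 10 ≤ dist (y a) (y b)) ∧ (∀ j : Fin N, dist (y j) (y i) ≤ R → ¬ Gy (1 / 20) N (y) j) ∧ (∀ j : Fin N, dist (y j) (y i) ≤ R → ¬ ((∀ j' : Fin N, dist (y j') (y j) ≤ R₇ → ¬ Gy (1 / 20) N (y) j') ∧ (∀ z : EuclideanSpace ℝ (Fin 3), dist z (y j) ≤ R₇ → ∃ k : Fin N, dist z (y k) ≤ 1) ∧ (∀ j' : Fin N, dist (y j') (y j) ≤ R₇ → (let d : ℝ := sInf ((fun z => dist z (y j')) '' (Set.range (y) \ {(y j')})); ∀ k : Fin N, y k ≠ y j' → dist (y k) (y j') < 27 / 20 * d → 5 ≤ Nat.card {m : Fin N // y m ≠ y j'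 ∧ dist (y m) (y j') < 27 / 20 * d ∧ y m ≠ y k ∧ dist (y m) (y k) < 27 / 20 * d})))) ∧ (∀ j : Fin N, dist (y j) (y i) ≤ R → ∃ k : Fin N, dist (y k) (y j) ≤ R₈ ∧ Gy (1 / 8) N (y) k) ∧ (∀ j : Fin N, dist (y j) (y i) ≤ R → ¬ ((∀ j' : Fin N, dist (y j') (y j) ≤ R₉ → ¬ Gy (1 / 20) N (y) j') ∧ (Nat.card {j' : Fin N // dist (y j') (y j) ≤ R₉ ∧ ¬ Gy (1 / 8) N (y) j'} : ℝ) ≤ 1 / 2 * (Nat.card {j' : Fin N // dist (y j') (y j) ≤ R₉} : ℝ) ∧ (∀ j' : Fin N, dist (y j') (y j) ≤ R₉ → ¬ Gy (1 / 8) N (y) j' → ¬ (let d : ℝ := sInf ((fun z => dist z (y j')) '' (Set.range (y) \ {(y j')})); ∀ k : Fin N, y k ≠ y j' → dist (y k) (y j') < 27 / 20 * d → 5 ≤ Nat.card {m : Fin N // y m ≠ y j' ∧ dist (y m) (y j') < 27 / 20 * d ∧ y m ≠ y k ∧ dist (y m) (y k) < 27 / 20 * d})))); ∃ r : ℝ,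 0 < r ∧ ∃ Rc : ℝ, 6 / 5 ≤ Rc ∧ ∀ ω : Finset (EuclideanSpace ℝ (Fin 3)), (0 : EuclideanSpace ℝ (Fin 3)) ∈ ω → (∀ p ∈ ω, ‖p‖ ≤ 2 * r + Rc + 1) → (∀ a ∈ ω, ∀ b ∈ ω, a ≠ b → δ ≤ dist a b) → (∀ a ∈ ω, ∀ b ∈ ω, a ≠ b → (7 : ℝ) / 10 ≤ dist a b) → (∀ q ∈ ω, ‖q‖ ≤ r → ∀ ε : ℝ, 0 < ε → ε ≤ 1 → ∃ (N : ℕ) (y : Fin N → EuclideanSpace ℝ (Fin 3)) (i : Fin N), TexBall N y i (r + Rc) R₇ R₈ R₉ ∧ (∀ p ∈ ω, dist p q ≤ r + Rc → ∃ k : Fin N, dist (y k - y i) (p - q) ≤ ε) ∧ (∀ k : Fin N, dist (y k) (y i) ≤ r + Rc → ∃ p ∈ ω, dist (y k - y i) (p - q) ≤ ε)) → (∀ p ∈ ω, ‖p‖ ≤ r → ∃ q ∈ ω, q ≠ p ∧ dist p q ^ 6 ≤ 11 / 5) → (∀ p ∈ ω, ‖p‖ ≤ r → 0 ≤ ∑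 q ∈ ω.filter (fun q : EuclideanSpace ℝ (Fin 3) => q ≠ p ∧ ‖q - p‖ ≤ Rc), (11 * (dist p q)⁻¹ ^ 14 - 5 * (dist p q)⁻¹ ^ 8)) → 0 < (∑ y ∈ ω.filter (fun y : EuclideanSpace ℝ (Fin 3) => ‖y‖ ≤ r), ((∑ q ∈ ω.filter (fun q : EuclideanSpace ℝ (Fin 3) => ‖q - y‖ ≤ Rc), Literature.MathematicalPhysics.StatisticalMechanics.lennardJones ‖q - y‖) / 2 - ((7 / 10 : ℝ)⁻¹ ^ 6 / 12 + 1 / 6) * (250 * (7 / 10 : ℝ)⁻¹ ^ 3 * Rc⁻¹ ^ 3) / 2 - (⨅ Q : Literature.MathematicalPhysics.StatisticalMechanics.PeriodicConfiguration 3, Q.energyPerParticle Literature.MathematicalPhysics.StatisticalMechanics.lennardJones)) / ((ω.filter (fun q : EuclideanSpace ℝ (Fin 3) => ‖q - y‖ ≤ r)).card : ℝ))) :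
    ∀ δ : ℝ, 0 < δ → ∀ P : MeasureTheory.Measure (MeasureTheory.Measure (EuclideanSpace ℝ (Fin 3))), let Gy : ℝ → (N : ℕ) → (Fin N → EuclideanSpace ℝ (Fin 3)) → Fin N → Prop := fun η N y j => let d : ℝ := sInf ((fun z => dist z (y (j : Fin N))) '' (Set.range (y) \ {(y (j : Fin N))})); let T : Set (EuclideanSpace ℝ (Fin 3)) := {z : EuclideanSpace ℝ (Fin 3) | z ∈ Set.range (y) ∧ z ≠ (y (j : Fin N)) ∧ dist z (y (j : Fin N)) < 13 / 10 * d}; ∃ A : EuclideanSpace ℝ (Fin 3) →ₗᵢ[ℝ] EuclideanSpace ℝ (Fin 3), (∃ e : ↥T ≃ ↥Literature.Geometry.DiscreteGeometry.fccKissingPattern, ∀ t : ↥T, dist (d⁻¹ • ((t : EuclideanSpace ℝ (Fin 3)) - (y (j : Fin N)))) (A ((e t : ↥Literature.Geometry.DiscreteGeometry.fccKissingPattern) : EuclideanSpace ℝ (Fin 3))) ≤ η) ∨ (∃ e : ↥T ≃ ↥Literature.Geometry.DiscreteGeometry.hcpKissingPattern, ∀ t : ↥T, dist (d⁻¹ •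 ((t : EuclideanSpace ℝ (Fin 3)) - (y (j : Fin N)))) (A ((e t : ↥Literature.Geometry.DiscreteGeometry.hcpKissingPattern) : EuclideanSpace ℝ (Fin 3))) ≤ η); let TexBall : (N : ℕ) → (Fin N → EuclideanSpace ℝ (Fin 3)) → Fin N → ℝ → ℝ → ℝ → ℝ → Prop := fun N y i R R₇ R₈ R₉ => (∀ a b : Fin N, a ≠ b → (7 : ℝ) / 10 ≤ dist (y a) (y b)) ∧ (∀ j : Fin N, dist (y j) (y i) ≤ R → ¬ Gy (1 / 20) N (y) j) ∧ (∀ j : Fin N, dist (y j) (y i) ≤ R → ¬ ((∀ j' : Fin N, dist (y j') (y j) ≤ R₇ → ¬ Gy (1 / 20) N (y) j') ∧ (∀ z : EuclideanSpace ℝ (Fin 3), dist z (y j) ≤ R₇ → ∃ k : Fin N, dist z (y k) ≤ 1) ∧ (∀ j' : Fin N, dist (y j') (y j) ≤ R₇ → (let d : ℝ := sInf ((fun z => dist z (y j')) '' (Set.range (y) \ {(y j')})); ∀ k : Fin N, y k ≠ y j' → dist (y k) (y j') < 27 / 20 * d → 5 ≤ Nat.card {m : Fin N // y m ≠ y j'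 ∧ dist (y m) (y j') < 27 / 20 * d ∧ y m ≠ y k ∧ dist (y m) (y k) < 27 / 20 * d})))) ∧ (∀ j : Fin N, dist (y j) (y i) ≤ R → ∃ k : Fin N, dist (y k) (y j) ≤ R₈ ∧ Gy (1 / 8) N (y) k) ∧ (∀ j : Fin N, dist (y j) (y i) ≤ R → ¬ ((∀ j' : Fin N, dist (y j') (y j) ≤ R₉ → ¬ Gy (1 / 20) N (y) j') ∧ (Nat.card {j' : Fin N // dist (y j') (y j) ≤ R₉ ∧ ¬ Gy (1 / 8) N (y) j'} : ℝ) ≤ 1 / 2 * (Nat.card {j' : Fin N // dist (y j') (y j) ≤ R₉} : ℝ) ∧ (∀ j' : Fin N, dist (y j') (y j) ≤ R₉ → ¬ Gy (1 / 8) N (y) j' → ¬ (let d : ℝ := sInf ((fun z => dist z (y j')) '' (Set.range (y) \ {(y j')})); ∀ k : Fin N, y k ≠ y j' → dist (y k) (y j') < 27 / 20 * d → 5 ≤ Nat.card {m : Fin N // y m ≠ y j' ∧ dist (y m) (y j') < 27 / 20 * d ∧ y m ≠ y k ∧ dist (y m) (y k) < 27 / 20 * d})))); let Appr : MeasureTheory.Measure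 (EuclideanSpace ℝ (Fin 3)) → ℝ → ℝ → ℝ → Prop := fun μ R₇ R₈ R₉ => ∀ q : EuclideanSpace ℝ (Fin 3), μ {q} ≠ 0 → ∀ R ε : ℝ, 0 < ε → ∃ (N : ℕ) (y : Fin N → EuclideanSpace ℝ (Fin 3)) (i : Fin N), TexBall N y i R R₇ R₈ R₉ ∧ (∀ p : EuclideanSpace ℝ (Fin 3), μ {p} ≠ 0 → dist p q ≤ R → ∃ k : Fin N, dist (y k - y i) (p - q) ≤ ε) ∧ (∀ k : Fin N, dist (y k) (y i) ≤ R → ∃ p : EuclideanSpace ℝ (Fin 3), μ {p} ≠ 0 ∧ dist (y k - y i) (p - q) ≤ ε); MeasureTheory.IsProbabilityMeasure P → (∀ᵐ μ ∂P, Literature.Probability.Process.IsRootedHardCore δ μ) → Literature.Probability.Process.IsPointStationaryLaw P → (∃ R₇ R₈ R₉ : ℝ, ∀ᵐ μ ∂P, Appr μ R₇ R₈ R₉) → (∀ᵐ μ ∂P, ∀ p : EuclideanSpace ℝ (Fin 3), μ {p} ≠ 0 → ∀ y : EuclideanSpace ℝ (Fin 3), (∀ q : EuclideanSpace ℝ (Fin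 3), μ {q} ≠ 0 → q ≠ p → y ≠ q) → ∑' q : {q : EuclideanSpace ℝ (Fin 3) // μ {q} ≠ 0 ∧ q ≠ p}, Literature.MathematicalPhysics.StatisticalMechanics.lennardJones (dist p (q : EuclideanSpace ℝ (Fin 3))) ≤ ∑' q : {q : EuclideanSpace ℝ (Fin 3) // μ {q} ≠ 0 ∧ q ≠ p}, Literature.MathematicalPhysics.StatisticalMechanics.lennardJones (dist y (q : EuclideanSpace ℝ (Fin 3)))) → P {μ : MeasureTheory.Measure (EuclideanSpace ℝ (Fin 3)) | ∃ Q : Literature.MathematicalPhysics.StatisticalMechanics.PeriodicConfiguration 3, ∃ t : EuclideanSpace ℝ (Fin 3), {p : EuclideanSpace ℝ (Fin 3) | μ {p} ≠ 0} = (fun s => s + t) '' Q.points} = 0 → (∀ A : Set (MeasureTheory.Measure (EuclideanSpace ℝ (Fin 3))), MeasurableSet A → (∀ μ : MeasureTheory.Measure (EuclideanSpace ℝ (Fin 3)), ∀ p : EuclideanSpace ℝ (Fin 3), μ {p} ≠ 0 → (μ ∈ A ↔ MeasureTheory.Measure.map (fun z : EuclideanSpace ℝ (Fin 3) => z - p)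 μ ∈ A)) → P A = 0 ∨ P Aᶜ = 0) → (⨅ Q : Literature.MathematicalPhysics.StatisticalMechanics.PeriodicConfiguration 3, Q.energyPerParticle Literature.MathematicalPhysics.StatisticalMechanics.lennardJones) < (∫ μ, Literature.MathematicalPhysics.StatisticalMechanics.rootEnergy Literature.MathematicalPhysics.StatisticalMechanics.lennardJones μ ∂P) :=
  aperiodicErgodicGap_of_truncatedSurplusPrice (truncatedSurplusPrice_of_equilibriumFiniteClusterPrice h)

/-- **EQUILIBRIUM-LOADED FINITE-CLUSTER DOOR for the `PeriodicChargeSplit` copy.** [folklore] -/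
theorem periodicChargeSplit_aperiodicFrustratedLawGap_of_equilibriumFiniteClusterPrice
    (h : ∀ δ : ℝ, 0 < δ → ∀ R₇ R₈ R₉ : ℝ, let Gy : ℝ → (N : ℕ) → (Fin N → EuclideanSpace ℝ (Fin 3)) → Fin N → Prop := fun η N y j => let d : ℝ := sInf ((fun z => dist z (y (j : Fin N))) '' (Set.range (y) \ {(y (j : Fin N))})); let T : Set (EuclideanSpace ℝ (Fin 3)) := {z : EuclideanSpace ℝ (Fin 3) | z ∈ Set.range (y) ∧ z ≠ (y (j : Fin N)) ∧ dist z (y (j : Fin N)) < 13 / 10 * d}; ∃ A : EuclideanSpace ℝ (Fin 3) →ₗᵢ[ℝ] EuclideanSpace ℝ (Fin 3), (∃ e : ↥T ≃ ↥Literature.Geometry.DiscreteGeometry.fccKissingPattern, ∀ t : ↥T, dist (d⁻¹ • ((t : EuclideanSpace ℝ (Fin 3)) - (y (j : Fin N)))) (A ((e t : ↥Literature.Geometry.DiscreteGeometry.fccKissingPattern) : EuclideanSpace ℝ (Fin 3))) ≤ η) ∨ (∃ e : ↥T ≃ ↥Literature.Geometry.DiscreteGeometry.hcpKissingPattern, ∀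 t : ↥T, dist (d⁻¹ • ((t : EuclideanSpace ℝ (Fin 3)) - (y (j : Fin N)))) (A ((e t : ↥Literature.Geometry.DiscreteGeometry.hcpKissingPattern) : EuclideanSpace ℝ (Fin 3))) ≤ η); let TexBall : (N : ℕ) → (Fin N → EuclideanSpace ℝ (Fin 3)) → Fin N → ℝ → ℝ → ℝ → ℝ → Prop := fun N y i R R₇ R₈ R₉ => (∀ a b : Fin N, a ≠ b → (7 : ℝ) / 10 ≤ dist (y a) (y b)) ∧ (∀ j : Fin N, dist (y j) (y i) ≤ R → ¬ Gy (1 / 20) N (y) j) ∧ (∀ j : Fin N, dist (y j) (y i) ≤ R → ¬ ((∀ j' : Fin N, dist (y j') (y j) ≤ R₇ → ¬ Gy (1 / 20) N (y) j') ∧ (∀ z : EuclideanSpace ℝ (Fin 3), dist z (y j) ≤ R₇ → ∃ k : Fin N, dist z (y k) ≤ 1) ∧ (∀ j' : Fin N, dist (y j') (y j) ≤ R₇ → (let d : ℝ := sInf ((fun z => dist z (y j')) '' (Set.range (y) \ {(y j')})); ∀ k : Fin N, y k ≠ y j' → dist (y k) (y j') < 27 / 20 * d → 5 ≤ Nat.card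 {m : Fin N // y m ≠ y j' ∧ dist (y m) (y j') < 27 / 20 * d ∧ y m ≠ y k ∧ dist (y m) (y k) < 27 / 20 * d})))) ∧ (∀ j : Fin N, dist (y j) (y i) ≤ R → ∃ k : Fin N, dist (y k) (y j) ≤ R₈ ∧ Gy (1 / 8) N (y) k) ∧ (∀ j : Fin N, dist (y j) (y i) ≤ R → ¬ ((∀ j' : Fin N, dist (y j') (y j) ≤ R₉ → ¬ Gy (1 / 20) N (y) j') ∧ (Nat.card {j' : Fin N // dist (y j') (y j) ≤ R₉ ∧ ¬ Gy (1 / 8) N (y) j'} : ℝ) ≤ 1 / 2 * (Nat.card {j' : Fin N // dist (y j') (y j) ≤ R₉} : ℝ) ∧ (∀ j' : Fin N, dist (y j') (y j) ≤ R₉ → ¬ Gy (1 / 8) N (y) j' → ¬ (let d : ℝ := sInf ((fun z => dist z (y j')) '' (Set.range (y) \ {(y j')})); ∀ k : Fin N, y k ≠ y j' → dist (y k) (y j') < 27 / 20 * d → 5 ≤ Nat.card {m : Fin N // y m ≠ y j' ∧ dist (y m) (y j') < 27 / 20 * d ∧ y m ≠ y k ∧ dist (y m) (y k) < 27 / 20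 * d})))); ∃ r : ℝ, 0 < r ∧ ∃ Rc : ℝ, 6 / 5 ≤ Rc ∧ ∀ ω : Finset (EuclideanSpace ℝ (Fin 3)), (0 : EuclideanSpace ℝ (Fin 3)) ∈ ω → (∀ p ∈ ω, ‖p‖ ≤ 2 * r + Rc + 1) → (∀ a ∈ ω, ∀ b ∈ ω, a ≠ b → δ ≤ dist a b) → (∀ a ∈ ω, ∀ b ∈ ω, a ≠ b → (7 : ℝ) / 10 ≤ dist a b) → (∀ q ∈ ω, ‖q‖ ≤ r → ∀ ε : ℝ, 0 < ε → ε ≤ 1 → ∃ (N : ℕ) (y : Fin N → EuclideanSpace ℝ (Fin 3)) (i : Fin N), TexBall N y i (r + Rc) R₇ R₈ R₉ ∧ (∀ p ∈ ω, dist p q ≤ r + Rc → ∃ k : Fin N, dist (y k - y i) (p - q) ≤ ε) ∧ (∀ k : Fin N, dist (y k) (y i) ≤ r + Rc → ∃ p ∈ ω, dist (y k - y i) (p - q) ≤ ε)) → (∀ p ∈ ω, ‖p‖ ≤ r → ∃ q ∈ ω, q ≠ p ∧ dist p q ^ 6 ≤ 11 / 5) → (∀ p ∈ ω, ‖p‖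 ≤ r → 0 ≤ ∑ q ∈ ω.filter (fun q : EuclideanSpace ℝ (Fin 3) => q ≠ p ∧ ‖q - p‖ ≤ Rc), (11 * (dist p q)⁻¹ ^ 14 - 5 * (dist p q)⁻¹ ^ 8)) → 0 < (∑ y ∈ ω.filter (fun y : EuclideanSpace ℝ (Fin 3) => ‖y‖ ≤ r), ((∑ q ∈ ω.filter (fun q : EuclideanSpace ℝ (Fin 3) => ‖q - y‖ ≤ Rc), Literature.MathematicalPhysics.StatisticalMechanics.lennardJones ‖q - y‖) / 2 - ((7 / 10 : ℝ)⁻¹ ^ 6 / 12 + 1 / 6) * (250 * (7 / 10 : ℝ)⁻¹ ^ 3 * Rc⁻¹ ^ 3) / 2 - (⨅ Q : Literature.MathematicalPhysics.StatisticalMechanics.PeriodicConfiguration 3, Q.energyPerParticle Literature.MathematicalPhysics.StatisticalMechanics.lennardJones)) / ((ω.filter (fun q : EuclideanSpace ℝ (Fin 3) => ‖q - y‖ ≤ r)).card : ℝ))) :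
    Summit.AtomisticToContinuum.Crystallization.Theses.PeriodicChargeSplit.AperiodicFrustratedLawGap :=
  periodicChargeSplit_aperiodicFrustratedLawGap_of_truncatedSurplusPrice (truncatedSurplusPrice_of_equilibriumFiniteClusterPrice h)

end Summit.AtomisticToContinuum.Crystallization.Theorems.FrustratedLawDichotomyTransportPriceFiniteEq

end
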